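import Literature.NumberTheory.Automorphic.AutomorphicGLnFlathExistsProofs
import Literature.NumberTheory.Automorphic.SupercuspidalSubrep
import Literature.NumberTheory.Automorphic.ParabolicGLReindex
import HarnessLib

/-!
# Irreducible admissible representations of a finite product are tensor products

Topic `NumberTheory/Automorphic`. The finite case of Flath's tensor product theorem, deduced from
the tree's restricted-product version (`flath_exists_holds_of_isTopologicalGroup`, Flath 1979,
Thm. 3; Bump 1997, Thm. 3.4.2): for a *finite* index type `ι` and topological groups `G i`
each having a compact open subgroup `K i`, every irreducible admissible representation `σ` of
`Π i, G i` on `W` is a tensor product of irreducible admissible representations `ρ i` on spaces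
`V i` (in the universe of `W`): there is a restricted-multilinear `j : RestrictedFamily V x₀ → W`
(`RestrictedTensorProduct`) whose values span `W` and which is equivariant,
`j (g • x) = σ g (j x)` for the coordinatewise action (`exists_tensorDecomposition`).

The transport `(Π i, G i) ≃* Πʳ i, [G i, K i]` for finite `ι` (`piEquivRestricted`, a
homeomorphism: `continuous_piEquivRestricted`, `isOpenMap_piEquivRestricted`) is the only new
ingredient. We also record that the tensor factors of an irreducible *supercuspidal* `σ` are
supercuspidal (`isSupercuspidal_factor`; Bernstein–Zelevinsky 1977, §4.7, via
`Representation.IsSupercuspidal.of_injective` applied to the slot embedding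
`y ↦ j (x.update i y)` over the open subgroup `G i × Π_{b ≠ i} L_b`).

Definitions with bodies (`piEquivRestricted`, `RestrictedFamily.piSmul`); theorems otherwise; no
named fact.

## References

* D. Flath, *Decomposition of representations into tensor products*, Proc. Sympos. Pure Math. 33
  (1979), part 1, Thm. 3. [FlathCorvallis1979]
* I. N. Bernstein, A. V. Zelevinsky, *Induced representations of reductive `p`-adic groups I*,
  Ann. Sci. ÉNS 10 (1977), §4.7; *Representations of the group `GL(n,F)`*, Russian Math. Surveys
  31:3 (1976), §2.16. [BernsteinZelevinskyASENS1977] [BernsteinZelevinskyRMS1976]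
-/

noncomputable section

open scoped RestrictedProduct
open Filter Function
open _root_.Topology

namespace Literature.NumberTheory.Automorphic

universe u v w

/-! ### Finite index types: `Π i, G i ≃ Πʳ i, [G i, K i]` -/

section FiniteIndex

variable {ι : Type u} [Finite ι] {G : ι → Type v} [∀ i, Group (G i)] (K : ∀ i, Subgroup (G i))

omit [∀ i, Group (G i)] in
/-- Over a finite index type every family lies eventually (for the cofinite filter, which is `⊥`)
in any prescribed sets. [folklore] -/
lemma eventually_mem_of_finite (A : ∀ i, Set (G i)) (f : Π i, G i) : ∀ᶠ i in cofinite, f i ∈ A i := by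
  rw [Filter.cofinite_eq_bot]
  exact Filter.eventually_bot

/-- **For finite `ι` the restricted product is the full product**: the canonical group
isomorphism `(Π i, G i) ≃* Πʳ i, [G i, K i]`. [folklore] -/
def piEquivRestricted : (Π i, G i) ≃* Πʳ i, [G i, K i] where
  toFun f := RestrictedProduct.mk f (eventually_mem_of_finite (fun i => (K i : Set (G i))) f)
  invFun x := ⇑x
  left_inv _ := rfl
  right_inv _ := by ext; rfl
  map_mul' _ _ := by ext; rfl

/-- Coordinates of `piEquivRestricted`. [folklore] -/
@[simp] lemma piEquivRestricted_apply (f : Π i, G i) (i : ι) : piEquivRestricted K f i = f i := rfl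

/-- The inverse of `piEquivRestricted` is the coercion. [folklore] -/
@[simp] lemma piEquivRestricted_symm_apply (x : Πʳ i, [G i, K i]) :
    (piEquivRestricted K).symm x = ⇑x := rfl

variable [∀ i, TopologicalSpace (G i)]

/-- `piEquivRestricted` is continuous: it is the inclusion from the principal restricted product
`Πʳ i, [G i, K i]_[𝓟 ∅]` (which carries the product topology). [folklore] -/
theorem continuous_piEquivRestricted : Continuous (piEquivRestricted (G := G) K) := by
  have hS : (cofinite : Filter ι) ≤ 𝓟 (∅ : Set ι) := by
    rw [Filter.cofinite_eq_bot]
    exact bot_le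
  let g₀ : (Π i, G i) → Πʳ i, [G i, K i]_[𝓟 (∅ : Set ι)] := fun f =>
    RestrictedProduct.mk f (by simp)
  have hg₀ : Continuous g₀ :=
    RestrictedProduct.continuous_rng_of_principal.2 (continuous_pi fun i => continuous_apply i)
  have : ⇑(piEquivRestricted (G := G) K) = RestrictedProduct.inclusion _ _ hS ∘ g₀ := by
    funext f
    ext i
    rfl
  rw [this]
  exact (RestrictedProduct.continuous_inclusion hS).comp hg₀

/-- `piEquivRestricted` is an open map (its inverse, the coercion, is continuous). [folklore] -/
theorem isOpenMap_piEquivRestricted : IsOpenMap (piEquivRestricted (G := G) K) := by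
  intro U hU
  rw [show (piEquivRestricted (G := G) K) '' U = (piEquivRestricted (G := G) K).symm ⁻¹' U from
    (piEquivRestricted (G := G) K).toEquiv.image_eq_preimage_symm U]
  exact hU.preimage RestrictedProduct.continuous_coe

/-- The coercion `Πʳ i, [G i, K i] → Π i, G i` is an open map for finite `ι`. [folklore] -/
theorem isOpenMap_piEquivRestricted_symm : IsOpenMap (piEquivRestricted (G := G) K).symm := by
  intro U hU
  rw [show ((piEquivRestricted (G := G) K).symm) '' U = (piEquivRestricted (G := G) K) ⁻¹' U from
    (piEquivRestricted (G := G) K).symm.toEquiv.image_eq_preimage_symm U]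
  exact hU.preimage (continuous_piEquivRestricted K)

end FiniteIndex

/-! ### The coordinatewise action of the full product on restricted families -/

section PiSmul

variable {ι : Type u} [Finite ι] {k : Type*} [CommRing k] {G : ι → Type v} [∀ i, Group (G i)]
  {V : ι → Type w} [∀ i, AddCommGroup (V i)] [∀ i, Module k (V i)]
  (ρ : ∀ i, Representation k (G i) (V i)) {x₀ : ∀ i, V i}

/-- The coordinatewise action `(g • x) i = ρ i (g i) (x i)` of the full product on restricted
families, for a finite index type. [folklore] -/
def RestrictedFamily.piSmul (g : Π i, G i) (x : RestrictedFamily V x₀) : RestrictedFamily V x₀ :=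
  RestrictedProduct.mk (fun i => ρ i (g i) (x i)) (eventually_mem_of_finite _ _)

/-- Coordinates of `piSmul`. [folklore] -/
@[simp] lemma RestrictedFamily.piSmul_apply (g : Π i, G i) (x : RestrictedFamily V x₀) (i : ι) :
    RestrictedFamily.piSmul ρ g x i = ρ i (g i) (x i) := rfl

variable [DecidableEq ι]

/-- `mulSingle i g • (x.update i y) = x.update i (ρ i g y)`. [folklore] -/
lemma RestrictedFamily.piSmul_mulSingle_update (x : RestrictedFamily V x₀) (i : ι) (g : G i) (y : V i) :
    RestrictedFamily.piSmul ρ (Pi.mulSingle i g) (x.update i y) = x.update i (ρ i g y) := by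
  ext b
  by_cases hb : b = i
  · subst hb
    simp
  · simp [hb]

/-- If `g b` fixes `x b` for all `b ≠ i`, then `g • (x.update i y) = x.update i (ρ i (g i) y)`. [folklore] -/
lemma RestrictedFamily.piSmul_update_of_forall (x : RestrictedFamily V x₀) (i : ι) (g : Π i, G i)
    (hg : ∀ b, b ≠ i → ρ b (g b) (x b) = x b) (y : V i) :
    RestrictedFamily.piSmul ρ g (x.update i y) = x.update i (ρ i (g i) y) := by
  ext b
  by_cases hb : b = i
  · subst hb
    simp
  · simp [hb, hg b hb]

end PiSmul

/-! ### Flath's theorem for finite products -/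

section Finite

variable {ι : Type u} [Finite ι] [DecidableEq ι] {G : ι → Type v} [∀ i, Group (G i)]
  [∀ i, TopologicalSpace (G i)] [∀ i, IsTopologicalGroup (G i)] {K : ∀ i, Subgroup (G i)}
  {W : Type w} [AddCommGroup W] [Module ℂ W]

omit [Finite ι] [∀ i, TopologicalSpace (G i)] [∀ i, IsTopologicalGroup (G i)] in
/-- The values of a restricted tensor product map span `W`. [folklore] -/
theorem span_range_eq_top_of_isRestrictedTensorProduct {V : ι → Type w} [∀ i, AddCommGroup (V i)]
    [∀ i, Module ℂ (V i)] {x₀ : ∀ i, V i} {j : RestrictedFamily V x₀ → W} {S₀ : Finset ι}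
    (h : IsRestrictedTensorProduct ℂ j S₀) : Submodule.span ℂ (Set.range j) = ⊤ := by
  rw [eq_top_iff, ← h.iSup_range_liftFinset, iSup_le_iff]
  intro S
  rw [IsRestrictedMultilinear.liftFinset, LinearMap.range_eq_map, ← PiTensorProduct.span_tprod_eq_top,
    Submodule.map_span, Submodule.span_le]
  rintro _ ⟨_, ⟨m, rfl⟩, rfl⟩
  refine Submodule.subset_span ⟨RestrictedFamily.extend S m, ?_⟩
  rw [PiTensorProduct.lift.tprod, IsRestrictedMultilinear.restrictMultilinear_apply]

/-- **Flath's theorem for a finite product** (Flath 1979, Thm. 3; Bump 1997, Thm. 3.4.2;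
Bernstein–Zelevinsky 1976, §2.16): let `ι` be finite, `G i` topological groups with compact open
subgroups `K i`, and `σ` an irreducible admissible representation of `Π i, G i` on `W`. Then there
are irreducible admissible representations `ρ i` of `G i` on spaces `V i` (in the universe of
`W`), base vectors `x₀` and a restricted-multilinear `j : RestrictedFamily V x₀ → W` whose values
span `W` and which is equivariant for the coordinatewise action: `j (g • x) = σ g (j x)`.
(Transport of `flath_exists_holds_of_isTopologicalGroup` along `piEquivRestricted`.)
[cite: FlathCorvallis1979, Theorem 3] -/
theorem exists_tensorDecomposition (hK : ∀ i, IsOpen (K i : Set (G i)))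
    (hKc : ∀ i, IsCompact (K i : Set (G i))) (σ : Representation ℂ (Π i, G i) W) [σ.IsIrreducible]
    (hadm : σ.IsAdmissible) :
    ∃ (V : ι → Type w) (_ : ∀ i, AddCommGroup (V i)) (_ : ∀ i, Module ℂ (V i))
      (ρ : ∀ i, Representation ℂ (G i) (V i)) (x₀ : ∀ i, V i) (j : RestrictedFamily V x₀ → W),
      IsRestrictedMultilinear ℂ j ∧ Submodule.span ℂ (Set.range j) = ⊤ ∧
        (∀ (g : Π i, G i) (x : RestrictedFamily V x₀), j (RestrictedFamily.piSmul ρ g x) = σ g (j x)) ∧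
        ∀ i, (ρ i).IsIrreducible ∧ (ρ i).IsAdmissible := by
  let e := piEquivRestricted (G := G) K
  let π : Representation ℂ (Πʳ i, [G i, K i]) W := σ.comp e.symm.toMonoidHom
  haveI : π.IsIrreducible := isIrreducible_comp_of_surjective σ e.symm.toMonoidHom e.symm.surjective
  have hπadm : π.IsAdmissible :=
    IsAdmissible.comp_of_isOpenMap σ e.symm.toMonoidHom RestrictedProduct.continuous_coe
      (isOpenMap_piEquivRestricted_symm K) hadm
  have hGP : ∀ᶠ i in cofinite, IsGelfandPair ℂ (G i) (K i) := by
    rw [Filter.cofinite_eq_bot]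
    exact Filter.eventually_bot
  obtain ⟨V, _, _, ρ, x₀, hx₀, j, S₀, hrtp, hρ, -⟩ :=
    flath_exists_holds_of_isTopologicalGroup (ι := ι) (G := G) (K := K) (W := W) hK hKc hGP π
      inferInstance hπadm
  refine ⟨V, inferInstance, inferInstance, ρ, x₀, j, hrtp.1.isRestrictedMultilinear,
    span_range_eq_top_of_isRestrictedTensorProduct hrtp.1, fun g x => ?_, hρ⟩
  have h := hrtp.map_smul (e g) x
  have hsm : RestrictedFamily.smul ρ hx₀ (e g) x = RestrictedFamily.piSmul ρ g x := by
    ext i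
    rfl
  rw [hsm] at h
  rw [h]
  change σ (e.symm (e g)) (j x) = σ g (j x)
  rw [MulEquiv.symm_apply_apply]

end Finite

/-! ### The tensor factors of a supercuspidal representation are supercuspidal -/

section Supercuspidal

variable {ι : Type u} [Finite ι] [DecidableEq ι] {G : ι → Type v} [∀ i, Group (G i)]
  [∀ i, TopologicalSpace (G i)] [∀ i, IsTopologicalGroup (G i)] {K : ∀ i, Subgroup (G i)}
  {W : Type w} [AddCommGroup W] [Module ℂ W] {σ : Representation ℂ (Π i, G i) W}
  {V : ι → Type w} [∀ i, AddCommGroup (V i)] [∀ i, Module ℂ (V i)]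
  {ρ : ∀ i, Representation ℂ (G i) (V i)} {x₀ : ∀ i, V i} {j : RestrictedFamily V x₀ → W}

omit [Finite ι] [∀ i, TopologicalSpace (G i)] [∀ i, IsTopologicalGroup (G i)] in
/-- The `i`-th coordinate of a central element of `Π i, G i` restricted to an "`i`-full"
subgroup is central in `G i`. [folklore] -/
private lemma apply_mem_center_of_mem_center {H : Subgroup (Π i, G i)} (i : ι)
    (hH : ∀ g : G i, Pi.mulSingle i g ∈ H) {z : H} (hz : z ∈ Subgroup.center H) :
    (z : Π i, G i) i ∈ Subgroup.center (G i) := by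
  rw [Subgroup.mem_center_iff] at hz ⊢
  intro g
  have := congrArg (fun h : H => (h : Π i, G i) i) (hz ⟨Pi.mulSingle i g, hH g⟩)
  simpa using this

/-- **The tensor factors of an irreducible supercuspidal representation of a finite product are
supercuspidal** (Bernstein–Zelevinsky 1977, §4.7, for the Levi subgroups `Π_a GL_{n_a}(F)`). Let
`σ` be smooth and supercuspidal on `W ≠ 0`, `j : RestrictedFamily V x₀ → W` restricted-multilinear,
equivariant (`j (g • x) = σ g (j x)`) with values spanning `W`, the `ρ b` smooth and `ρ i`
irreducible. Then `ρ i` is supercuspidal: for `x` with `j x ≠ 0` the slot map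
`y ↦ j (x.update i y)` is an injective intertwining map from `ρ i` (inflated to the open subgroup
`H = {h | h b ∈ L_b (b ≠ i)}`, `L_b ≤ K b` compact open fixing `x b`) into `σ|_H`, which is
supercuspidal (`IsSupercuspidal.compSubtype`); so the inflation is supercuspidal
(`IsSupercuspidal.of_injective`), and a coefficient of `ρ i` supported in `C · Z(H)` along
`g ↦ mulSingle i g` is supported in `C_i · Z(G i)`. [cite: BernsteinZelevinskyASENS1977, §4.7] -/
theorem isSupercuspidal_factor [Nontrivial W] (hK : ∀ i, IsOpen (K i : Set (G i)))
    (hKc : ∀ i, IsCompact (K i : Set (G i))) (hσ : σ.IsSmooth) (hsc : σ.IsSupercuspidal)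
    (hj : IsRestrictedMultilinear ℂ j) (hspan : Submodule.span ℂ (Set.range j) = ⊤)
    (hequiv : ∀ (g : Π i, G i) (x : RestrictedFamily V x₀), j (RestrictedFamily.piSmul ρ g x) = σ g (j x))
    (hρs : ∀ b, (ρ b).IsSmooth) (i : ι) [(ρ i).IsIrreducible] : (ρ i).IsSupercuspidal := by
  classical
  -- a family `x` with `j x ≠ 0`
  obtain ⟨x, hx⟩ : ∃ x : RestrictedFamily V x₀, j x ≠ 0 := by
    by_contra h
    push Not at h
    have : Submodule.span ℂ (Set.range j) = ⊥ := by
      rw [Submodule.span_eq_bot]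
      rintro _ ⟨x, rfl⟩
      exact h x
    rw [this] at hspan
    exact bot_ne_top hspan
  -- compact open subgroups `L b ≤ K b` fixing `x b`
  let L : ∀ b, Subgroup (G b) := fun b => K b ⊓ (ρ b).stabilizerSubgroup (x b)
  have hLo : ∀ b, IsOpen (L b : Set (G b)) := fun b => (hK b).inter (hρs b (x b))
  have hLc : ∀ b, IsCompact (L b : Set (G b)) := fun b =>
    (hKc b).of_isClosed_subset ((L b).isClosed_of_isOpen (hLo b)) fun g hg => hg.1
  have hLx : ∀ b, ∀ g ∈ L b, ρ b g (x b) = x b := fun b g hg => hg.2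
  -- the open subgroup `H = G i × Π_{b ≠ i} L b`
  let Hs : ∀ b, Subgroup (G b) := fun b => if b = i then ⊤ else L b
  let H : Subgroup (Π b, G b) := Subgroup.pi Set.univ Hs
  have hHo : IsOpen (H : Set (Π b, G b)) := by
    rw [Subgroup.coe_pi]
    refine isOpen_set_pi Set.finite_univ fun b _ => ?_
    by_cases hb : b = i
    · simp only [Hs, if_pos hb, Subgroup.coe_top]
      exact isOpen_univ
    · simp only [Hs, if_neg hb]
      exact hLo b
  have hHmem : ∀ {h : Π b, G b}, h ∈ H ↔ ∀ b, b ≠ i → h b ∈ L b := by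
    intro h
    simp only [H, Subgroup.mem_pi, Set.mem_univ, true_implies, Hs]
    refine ⟨fun hh b hb => ?_, fun hh b => ?_⟩
    · have := hh b
      rwa [if_neg hb] at this
    · by_cases hb : b = i
      · rw [if_pos hb]; trivial
      · rw [if_neg hb]; exact hh b hb
  have hHi : ∀ g : G i, Pi.mulSingle i g ∈ H := fun g =>
    hHmem.2 fun b hb => by rw [Pi.mulSingle_eq_of_ne hb]; exact (L b).one_mem
  -- `σ|_H` is smooth and supercuspidal
  let σH : Representation ℂ H W := σ.comp H.subtype
  have hσH : σH.IsSmooth := IsSmooth.comp_of_continuous σ H.subtype continuous_subtype_val hσ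
  have hσHc : σH.IsSupercuspidal := hsc.compSubtype H hHo
  -- the inflation `τ` of `ρ i` to `H` and the slot map `T : τ → σ|_H`
  let τ : Representation ℂ H (V i) := (ρ i).comp ((Pi.evalMonoidHom G i).comp H.subtype)
  have hτ_apply : ∀ (h : H) (y : V i), τ h y = ρ i ((h : Π b, G b) i) y := fun _ _ => rfl
  let T₀ : V i →ₗ[ℂ] W :=
    { toFun := fun y => j (x.update i y)
      map_add' := hj.map_update_add x i
      map_smul' := hj.map_update_smul x i }
  have hT₀ : ∀ (h : H) (y : V i), T₀ (τ h y) = σH h (T₀ y) := by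
    intro h y
    change j (x.update i (ρ i ((h : Π b, G b) i) y)) = σ (h : Π b, G b) (j (x.update i y))
    rw [← hequiv, RestrictedFamily.piSmul_update_of_forall ρ x i (h : Π b, G b)
      (fun b hb => hLx b _ (hHmem.1 h.2 b hb))]
  let T : τ.IntertwiningMap σH := T₀.intertwiningMap_of_isIntertwiningMap τ σH hT₀
  have hT_apply : ∀ y, T y = j (x.update i y) := fun _ => rfl
  -- `T` is injective: its kernel is a proper `ρ i`-stable subspace
  have hker : LinearMap.ker T.toLinearMap = ⊥ := by
    obtain ⟨U, hU⟩ : ∃ U : Subrepresentation (ρ i), U.toSubmodule = LinearMap.ker T.toLinearMap :=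
      ⟨⟨LinearMap.ker T.toLinearMap, fun g v hv => by
          rw [LinearMap.mem_ker] at hv ⊢
          have h1 : T (τ ⟨Pi.mulSingle i g, hHi g⟩ v) = σH ⟨Pi.mulSingle i g, hHi g⟩ (T v) :=
            T.isIntertwining _ _ _ _
          rw [hτ_apply] at h1
          simp only [Pi.mulSingle_eq_same] at h1
          change T (ρ i g v) = 0
          rw [h1, show T v = 0 from hv, map_zero]⟩, rfl⟩
    have hUtop : U ≠ ⊤ := fun h => by
      have hmem : x i ∈ U.toSubmodule := by rw [h]; trivial
      rw [hU, LinearMap.mem_ker] at hmem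
      apply hx
      have : T (x i) = j x := by
        rw [hT_apply]
        congr 1
        ext b
        simp
      rw [← this]
      exact hmem
    have hUbot : U = ⊥ := (IsSimpleOrder.eq_bot_or_eq_top U).resolve_right hUtop
    rw [← hU, hUbot]
    rfl
  have hTinj : Function.Injective T := LinearMap.ker_eq_bot.1 hker
  -- a compact open subgroup of `H`
  let K₁ : Subgroup (Π b, G b) := Subgroup.pi Set.univ L
  have hK₁o : IsOpen (K₁ : Set (Π b, G b)) := by
    rw [Subgroup.coe_pi]
    exact isOpen_set_pi Set.finite_univ fun b _ => hLo b
  have hK₁c : IsCompact (K₁ : Set (Π b, G b)) := by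
    rw [Subgroup.coe_pi]
    exact isCompact_univ_pi fun b => hLc b
  let K₀ : Subgroup H := K₁.comap H.subtype
  have hK₀o : IsOpen (K₀ : Set H) := hK₁o.preimage continuous_subtype_val
  have hK₀c : IsCompact (K₀ : Set H) := by
    have hHc : IsClosed (H : Set (Π b, G b)) := H.isClosed_of_isOpen hHo
    rw [Subgroup.coe_comap, Subgroup.coe_subtype]
    exact hHc.isClosedEmbedding_subtypeVal.isCompact_preimage hK₁c
  -- `τ` is supercuspidal
  have hτ : τ.IsSupercuspidal := Representation.IsSupercuspidal.of_injective hσHc hσH hK₀o hK₀c T hTinj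
  -- from `τ` to `ρ i` along `g ↦ mulSingle i g`
  intro φ hφ v
  have hφτ : φ ∈ τ.contragredient := by
    rw [Representation.mem_contragredient] at hφ ⊢
    have hcont : Continuous ((Pi.evalMonoidHom G i).comp H.subtype) :=
      (continuous_apply i).comp continuous_subtype_val
    refine τ.dual.isSmoothVector_of_le
      (K := ((ρ i).dual.stabilizerSubgroup φ).comap ((Pi.evalMonoidHom G i).comp H.subtype)) ?_
      fun h hh => ?_
    · rw [Subgroup.coe_comap]
      exact hφ.preimage hcont
    rw [Representation.mem_stabilizerSubgroup]
    have hh' : (ρ i).dual ((h : Π b, G b) i) φ = φ := hh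
    refine LinearMap.ext fun y => ?_
    have := LinearMap.congr_fun hh' y
    simp only [Representation.dual_apply, Module.Dual.transpose_apply, LinearMap.comp_apply] at this ⊢
    rw [hτ_apply, Subgroup.coe_inv, Pi.inv_apply]
    exact this
  obtain ⟨C, hC, hsupp⟩ := hτ φ hφτ v
  refine ⟨(fun h : H => (h : Π b, G b) i) '' C, hC.image ((continuous_apply i).comp continuous_subtype_val),
    fun g hg => ?_⟩
  have hg' : (⟨Pi.mulSingle i g, hHi g⟩ : H) ∈ Function.support (τ.matrixCoeff φ v) := by
    rw [Function.mem_support, Representation.matrixCoeff_apply] at hg ⊢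
    rw [hτ_apply]
    simpa using hg
  obtain ⟨c, hc, z, hz, hcz⟩ := Set.mem_mul.1 (hsupp hg')
  refine Set.mem_mul.2 ⟨(c : Π b, G b) i, Set.mem_image_of_mem _ hc, (z : Π b, G b) i,
    apply_mem_center_of_mem_center i hHi hz, ?_⟩
  have := congrArg (fun h : H => (h : Π b, G b) i) hcz
  simpa using this

end Supercuspidal

end Literature.NumberTheory.Automorphic
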